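import Summits.CriticalPhenomena.PercolationContinuityZ3.Theorems.PercNearOneGluingNoHeavyQuantFarSunLayerTwoMid
import Summits.CriticalPhenomena.PercolationContinuityZ3.Theorems.PercNearOneGluingNoHeavyQuantFarSunCertBoxes1
import Summits.CriticalPhenomena.PercolationContinuityZ3.Theorems.PercNearOneGluingNoHeavyQuantFarSunCertCells14
import Summits.CriticalPhenomena.PercolationContinuityZ3.Theorems.PercNearOneGluingNoHeavyQuantFarSunCertCells14B
import Mathlib.Tactic.Linarith
import HarnessLib

/-!
# FAR beyond trees: LAYER 2 IN THE MIDDLE RANGE — the per-`K` certificates on `R` for `K = 14`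

builds on p205010 (kernel theorem, internal audit signed; external expert review pending)

Support file (`--supports stmt-CriticalPhenomena-4575`), seat `prim-cert-1` (gen 39); memo `prim-cert-1/FROM-prim-cert-1-g39-VERTEX-GAME.md` §4 (L5), §5.
Same pattern as `HairyCycle.witGavg_ge_one_of_R_17` (…LayerTwoMid): on `R` with `4 < Σ`, either `Σ ≥ 14` (LEMMA 1), or `η ≥ η₁(K)` (Region I box
certificate), or `η` lies in one of the η-cells below `η₁(K)` (slab bound `slab_K_i` of …Regions/…RegionsB + cell certificate), and in every case
`1 ≤ witGavg K h 2`; hence a hair-only certificate (`hairCert_of_witAvg`).  Cells, letters and budgets: seat folder work/dpc/cellplan2.json (memo §5).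
Elementary [this work]; no sorries; standard axioms (+ `Lean.ofReduceBool` through the certificates).
-/

noncomputable section

namespace Summit.CriticalPhenomena.PercolationContinuityZ3.Theorems.HairyCycle

open Finset

/-- `K = 14`: on `R` the averaged witness weight is `≥ 1` (LEMMA 1 ∨ box `[1/4, 1]^14` ∨ one of 5 cells). [this work] -/
theorem witGavg_ge_one_of_R_14 {h : ℕ → ℝ} (hh : ∀ k, 0 ≤ h k ∧ h k ≤ 1) {m : ℕ} (hmin : ∀ k, k < 14 → h m ≤ h k)
    (hS4 : (4 : ℝ) < ∑ k ∈ range 14, h k) (hR : 2 * (hairV 14 h 2 (range 14) - h m) < h m * (∑ k ∈ range 14, h k - 4)) :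
    1 ≤ witGavg 14 h 2 := by
  have hηpos : 0 < h m := by
    have hη := eta_mul_gt_two_of_R hh hmin hS4 hR
    by_contra h0; push Not at h0
    have : h m = 0 := le_antisymm h0 (hh m).1
    rw [this] at hη; linarith
  have hpos1 : ∀ k, k < 14 → 0 < h k ∧ h k ≤ 1 := fun k hk => ⟨lt_of_lt_of_le hηpos (hmin k hk), (hh k).2⟩
  have hpos : ∀ k, k < 14 → 0 < h k := fun k hk => (hpos1 k hk).1
  by_cases h14 : 14 ≤ ∑ k ∈ range 14, h k
  · exact witGavg_ge_one_of_sum_ge hpos1 h14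
  push Not at h14
  have hη : (2 : ℝ) / 13 < h m := eta_gt_of_R_of_sum_lt hh hmin hS4 h14 hR
  by_cases hbox : (1 : ℝ) / 4 ≤ h m
  · exact witGavg_ge_one_of_boxCert boxWF_14 (by decide) (by decide) (by decide) le_rfl (by decide) rfl boxCert_14
      (fun k hk => ⟨by push_cast; linarith [hmin k hk], (hh k).2⟩)
  push Not at hbox
  by_cases hlo0 : (19 / 80 : ℝ) ≤ h m
  · -- cell [19/80, 1/4)
    have hslab := slab_14_4 hh hbox hS4 hR
    classical
    let c : ℕ → ℕ := fun k => if h k ≤ 2 / 5 then 0 else if h k ≤ 3 / 5 then 1 else if h k ≤ 4 / 5 then 2 else 3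
    have hg0 : GameSpec.gOf (⟨8, 2, 3, 14, 80, 132, [(19, 2), (32, 3), (48, 4), (64, 5), (80, 5)]⟩ : GameSpec) 0 = 19 / 80 := by norm_num [GameSpec.gOf, GameSpec.kOf]
    have hg1 : GameSpec.gOf (⟨8, 2, 3, 14, 80, 132, [(19, 2), (32, 3), (48, 4), (64, 5), (80, 5)]⟩ : GameSpec) 1 = 2 / 5 := by norm_num [GameSpec.gOf, GameSpec.kOf]
    have hg2 : GameSpec.gOf (⟨8, 2, 3, 14, 80, 132, [(19, 2), (32, 3), (48, 4), (64, 5), (80, 5)]⟩ : GameSpec) 2 = 3 / 5 := by norm_num [GameSpec.gOf, GameSpec.kOf]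
    have hg3 : GameSpec.gOf (⟨8, 2, 3, 14, 80, 132, [(19, 2), (32, 3), (48, 4), (64, 5), (80, 5)]⟩ : GameSpec) 3 = 4 / 5 := by norm_num [GameSpec.gOf, GameSpec.kOf]
    have hg4 : GameSpec.gOf (⟨8, 2, 3, 14, 80, 132, [(19, 2), (32, 3), (48, 4), (64, 5), (80, 5)]⟩ : GameSpec) 4 = 1 := by norm_num [GameSpec.gOf, GameSpec.kOf]
    refine witGavg_ge_one_of_cellGame (K := 14) (P := (⟨8, 2, 3, 14, 80, 132, [(19, 2), (32, 3), (48, 4), (64, 5), (80, 5)]⟩ : GameSpec)) cellWFB_14_4 (by decide) (by decide) (by decide) (wmax := 5) (Bmin := 49)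
      cellCertB_14_4 (υ := 1 / 5) (S := 4861 / 500) (by norm_num) ?_ ?_ c ?_ ?_ hpos (by norm_num at hslab ⊢; linarith) (by norm_num)
    · intro j hj
      have hj' : j < 4 := by change j + 1 < 5 at hj; omega
      interval_cases j
      · rw [hg1]; norm_num [GameSpec.wOf]
      · rw [hg2]; norm_num [GameSpec.wOf]
      · rw [hg3]; norm_num [GameSpec.wOf]
      · rw [hg4]; norm_num [GameSpec.wOf]
    · intro j hj
      have hj' : j < 5 := hj
      interval_cases j <;> decide
    · intro k _
      simp only [c]; split_ifs <;> decide
    · intro k hk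
      have hlo : (19 / 80 : ℝ) ≤ h k := le_trans hlo0 (hmin k hk)
      have hup : h k ≤ 1 := (hh k).2
      simp only [c]
      split_ifs with h1 h2 h3
      · exact ⟨by rw [hg0]; exact hlo, by rw [hg1]; exact h1⟩
      · exact ⟨by rw [hg1]; linarith, by rw [hg2]; exact h2⟩
      · exact ⟨by rw [hg2]; linarith, by rw [hg3]; exact h3⟩
      · exact ⟨by rw [hg3]; linarith, by rw [hg4]; exact hup⟩
  push Not at hlo0
  by_cases hlo1 : (9 / 40 : ℝ) ≤ h m
  · -- cell [9/40, 19/80)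
    have hslab := slab_14_3 hh hlo0 hS4 hR
    classical
    let c : ℕ → ℕ := fun k => if h k ≤ 1 / 2 then 0 else if h k ≤ 3 / 4 then 1 else 2
    have hg0 : GameSpec.gOf (⟨9, 2, 4, 14, 40, 660, [(9, 2), (20, 3), (30, 4), (40, 4)]⟩ : GameSpec) 0 = 9 / 40 := by norm_num [GameSpec.gOf, GameSpec.kOf]
    have hg1 : GameSpec.gOf (⟨9, 2, 4, 14, 40, 660, [(9, 2), (20, 3), (30, 4), (40, 4)]⟩ : GameSpec) 1 = 1 / 2 := by norm_num [GameSpec.gOf, GameSpec.kOf]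
    have hg2 : GameSpec.gOf (⟨9, 2, 4, 14, 40, 660, [(9, 2), (20, 3), (30, 4), (40, 4)]⟩ : GameSpec) 2 = 3 / 4 := by norm_num [GameSpec.gOf, GameSpec.kOf]
    have hg3 : GameSpec.gOf (⟨9, 2, 4, 14, 40, 660, [(9, 2), (20, 3), (30, 4), (40, 4)]⟩ : GameSpec) 3 = 1 := by norm_num [GameSpec.gOf, GameSpec.kOf]
    refine witGavg_ge_one_of_cellGame (K := 14) (P := (⟨9, 2, 4, 14, 40, 660, [(9, 2), (20, 3), (30, 4), (40, 4)]⟩ : GameSpec)) cellWFB_14_3 (by decide) (by decide) (by decide) (wmax := 4) (Bmin := 41)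
      cellCertB_14_3 (υ := 1 / 4) (S := 1274 / 125) (by norm_num) ?_ ?_ c ?_ ?_ hpos (by norm_num at hslab ⊢; linarith) (by norm_num)
    · intro j hj
      have hj' : j < 3 := by change j + 1 < 4 at hj; omega
      interval_cases j
      · rw [hg1]; norm_num [GameSpec.wOf]
      · rw [hg2]; norm_num [GameSpec.wOf]
      · rw [hg3]; norm_num [GameSpec.wOf]
    · intro j hj
      have hj' : j < 4 := hj
      interval_cases j <;> decide
    · intro k _
      simp only [c]; split_ifs <;> decide
    · intro k hk
      have hlo : (9 / 40 : ℝ) ≤ h k := le_trans hlo1 (hmin k hk)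
      have hup : h k ≤ 1 := (hh k).2
      simp only [c]
      split_ifs with h1 h2
      · exact ⟨by rw [hg0]; exact hlo, by rw [hg1]; exact h1⟩
      · exact ⟨by rw [hg1]; linarith, by rw [hg2]; exact h2⟩
      · exact ⟨by rw [hg2]; linarith, by rw [hg3]; exact hup⟩
  push Not at hlo1
  by_cases hlo2 : (1 / 5 : ℝ) ≤ h m
  · -- cell [1/5, 9/40)
    have hslab := slab_14_2 hh hlo1 hS4 hR
    classical
    let c : ℕ → ℕ := fun k => if h k ≤ 1 / 2 then 0 else if h k ≤ 3 / 4 then 1 else 2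
    have hg0 : GameSpec.gOf (⟨8, 2, 3, 14, 20, 132, [(4, 2), (10, 3), (15, 4), (20, 4)]⟩ : GameSpec) 0 = 1 / 5 := by norm_num [GameSpec.gOf, GameSpec.kOf]
    have hg1 : GameSpec.gOf (⟨8, 2, 3, 14, 20, 132, [(4, 2), (10, 3), (15, 4), (20, 4)]⟩ : GameSpec) 1 = 1 / 2 := by norm_num [GameSpec.gOf, GameSpec.kOf]
    have hg2 : GameSpec.gOf (⟨8, 2, 3, 14, 20, 132, [(4, 2), (10, 3), (15, 4), (20, 4)]⟩ : GameSpec) 2 = 3 / 4 := by norm_num [GameSpec.gOf, GameSpec.kOf]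
    have hg3 : GameSpec.gOf (⟨8, 2, 3, 14, 20, 132, [(4, 2), (10, 3), (15, 4), (20, 4)]⟩ : GameSpec) 3 = 1 := by norm_num [GameSpec.gOf, GameSpec.kOf]
    refine witGavg_ge_one_of_cellGame (K := 14) (P := (⟨8, 2, 3, 14, 20, 132, [(4, 2), (10, 3), (15, 4), (20, 4)]⟩ : GameSpec)) cellWF_14_2 (by decide) (by decide) (by decide) (wmax := 4) (Bmin := 43)
      cellCertB_14_2 (υ := 1 / 4) (S := 10701 / 1000) (by norm_num) ?_ ?_ c ?_ ?_ hpos (by norm_num at hslab ⊢; linarith) (by norm_num)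
    · intro j hj
      have hj' : j < 3 := by change j + 1 < 4 at hj; omega
      interval_cases j
      · rw [hg1]; norm_num [GameSpec.wOf]
      · rw [hg2]; norm_num [GameSpec.wOf]
      · rw [hg3]; norm_num [GameSpec.wOf]
    · intro j hj
      have hj' : j < 4 := hj
      interval_cases j <;> decide
    · intro k _
      simp only [c]; split_ifs <;> decide
    · intro k hk
      have hlo : (1 / 5 : ℝ) ≤ h k := le_trans hlo2 (hmin k hk)
      have hup : h k ≤ 1 := (hh k).2
      simp only [c]
      split_ifs with h1 h2
      · exact ⟨by rw [hg0]; exact hlo, by rw [hg1]; exact h1⟩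
      · exact ⟨by rw [hg1]; linarith, by rw [hg2]; exact h2⟩
      · exact ⟨by rw [hg2]; linarith, by rw [hg3]; exact hup⟩
  push Not at hlo2
  by_cases hlo3 : (7 / 40 : ℝ) ≤ h m
  · -- cell [7/40, 1/5)
    have hslab := slab_14_1 hh hlo2 hS4 hR
    classical
    let c : ℕ → ℕ := fun k => if h k ≤ 1 / 2 then 0 else if h k ≤ 3 / 4 then 1 else 2
    have hg0 : GameSpec.gOf (⟨8, 2, 3, 14, 40, 132, [(7, 2), (20, 3), (30, 4), (40, 4)]⟩ : GameSpec) 0 = 7 / 40 := by norm_num [GameSpec.gOf, GameSpec.kOf]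
    have hg1 : GameSpec.gOf (⟨8, 2, 3, 14, 40, 132, [(7, 2), (20, 3), (30, 4), (40, 4)]⟩ : GameSpec) 1 = 1 / 2 := by norm_num [GameSpec.gOf, GameSpec.kOf]
    have hg2 : GameSpec.gOf (⟨8, 2, 3, 14, 40, 132, [(7, 2), (20, 3), (30, 4), (40, 4)]⟩ : GameSpec) 2 = 3 / 4 := by norm_num [GameSpec.gOf, GameSpec.kOf]
    have hg3 : GameSpec.gOf (⟨8, 2, 3, 14, 40, 132, [(7, 2), (20, 3), (30, 4), (40, 4)]⟩ : GameSpec) 3 = 1 := by norm_num [GameSpec.gOf, GameSpec.kOf]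
    refine witGavg_ge_one_of_cellGame (K := 14) (P := (⟨8, 2, 3, 14, 40, 132, [(7, 2), (20, 3), (30, 4), (40, 4)]⟩ : GameSpec)) cellWF_14_1 (by decide) (by decide) (by decide) (wmax := 4) (Bmin := 48)
      cellCert_14_1 (υ := 1 / 4) (S := 1484 / 125) (by norm_num) ?_ ?_ c ?_ ?_ hpos (by norm_num at hslab ⊢; linarith) (by norm_num)
    · intro j hj
      have hj' : j < 3 := by change j + 1 < 4 at hj; omega
      interval_cases j
      · rw [hg1]; norm_num [GameSpec.wOf]
      · rw [hg2]; norm_num [GameSpec.wOf]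
      · rw [hg3]; norm_num [GameSpec.wOf]
    · intro j hj
      have hj' : j < 4 := hj
      interval_cases j <;> decide
    · intro k _
      simp only [c]; split_ifs <;> decide
    · intro k hk
      have hlo : (7 / 40 : ℝ) ≤ h k := le_trans hlo3 (hmin k hk)
      have hup : h k ≤ 1 := (hh k).2
      simp only [c]
      split_ifs with h1 h2
      · exact ⟨by rw [hg0]; exact hlo, by rw [hg1]; exact h1⟩
      · exact ⟨by rw [hg1]; linarith, by rw [hg2]; exact h2⟩
      · exact ⟨by rw [hg2]; linarith, by rw [hg3]; exact hup⟩
  push Not at hlo3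
  -- last cell [3/20, 7/40)
  have hlo4 : (3 / 20 : ℝ) ≤ h m := by linarith
  have hslab := slab_14_0 hh hlo3 hS4 hR
  classical
  let c : ℕ → ℕ := fun k => if h k ≤ 1 / 2 then 0 else if h k ≤ 3 / 4 then 1 else 2
  have hg0 : GameSpec.gOf (⟨8, 2, 3, 14, 20, 132, [(3, 2), (10, 3), (15, 4), (20, 4)]⟩ : GameSpec) 0 = 3 / 20 := by norm_num [GameSpec.gOf, GameSpec.kOf]
  have hg1 : GameSpec.gOf (⟨8, 2, 3, 14, 20, 132, [(3, 2), (10, 3), (15, 4), (20, 4)]⟩ : GameSpec) 1 = 1 / 2 := by norm_num [GameSpec.gOf, GameSpec.kOf]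
  have hg2 : GameSpec.gOf (⟨8, 2, 3, 14, 20, 132, [(3, 2), (10, 3), (15, 4), (20, 4)]⟩ : GameSpec) 2 = 3 / 4 := by norm_num [GameSpec.gOf, GameSpec.kOf]
  have hg3 : GameSpec.gOf (⟨8, 2, 3, 14, 20, 132, [(3, 2), (10, 3), (15, 4), (20, 4)]⟩ : GameSpec) 3 = 1 := by norm_num [GameSpec.gOf, GameSpec.kOf]
  refine witGavg_ge_one_of_cellGame (K := 14) (P := (⟨8, 2, 3, 14, 20, 132, [(3, 2), (10, 3), (15, 4), (20, 4)]⟩ : GameSpec)) cellWF_14_0 (by decide) (by decide) (by decide) (wmax := 4) (Bmin := 54)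
    cellCert_14_0 (υ := 1 / 4) (S := 6679 / 500) (by norm_num) ?_ ?_ c ?_ ?_ hpos (by norm_num at hslab ⊢; linarith) (by norm_num)
  · intro j hj
    have hj' : j < 3 := by change j + 1 < 4 at hj; omega
    interval_cases j
    · rw [hg1]; norm_num [GameSpec.wOf]
    · rw [hg2]; norm_num [GameSpec.wOf]
    · rw [hg3]; norm_num [GameSpec.wOf]
  · intro j hj
    have hj' : j < 4 := hj
    interval_cases j <;> decide
  · intro k _
    simp only [c]; split_ifs <;> decide
  · intro k hk
    have hlo : (3 / 20 : ℝ) ≤ h k := le_trans hlo4 (hmin k hk)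
    have hup : h k ≤ 1 := (hh k).2
    simp only [c]
    split_ifs with h1 h2
    · exact ⟨by rw [hg0]; exact hlo, by rw [hg1]; exact h1⟩
    · exact ⟨by rw [hg1]; linarith, by rw [hg2]; exact h2⟩
    · exact ⟨by rw [hg2]; linarith, by rw [hg3]; exact hup⟩

/-- **`K = 14`: a hair-only certificate on `R`.** [this work] -/
theorem hairCert_two_of_R_14 {h : ℕ → ℝ} (hh : ∀ k, 0 ≤ h k ∧ h k ≤ 1) {m : ℕ} (hmin : ∀ k, k < 14 → h m ≤ h k)
    (hS4 : (4 : ℝ) < ∑ k ∈ range 14, h k) (hR : 2 * (hairV 14 h 2 (range 14) - h m) < h m * (∑ k ∈ range 14, h k - 4)) :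
    ∃ lam : ℕ → ℝ, ∃ μ : ℝ, (∀ k, 0 ≤ lam k) ∧ ∑ k ∈ range 14, lam k = 1 ∧ 0 ≤ μ ∧
      ∀ p ∈ arcIx 14, ∑ k ∈ cov 14 p.1 p.2, lam k * h k + μ * (∑ k ∈ cov 14 p.1 p.2, h k - 2 * (2 : ℕ)) ≤ hairV 14 h 2 (cov 14 p.1 p.2) :=
  hairCert_of_witAvg (fun k _ => hh k) (witGavg_ge_one_of_R_14 hh hmin hS4 hR)

end Summit.CriticalPhenomena.PercolationContinuityZ3.Theorems.HairyCycle

end
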